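import Summits.ResolutionOfSingularities.ResolutionOfSingularities.Theses.FoliationDescent
import HarnessLib

/-!
# Crux `FolLU` (stmt-ResolutionOfSingularities-17081), line `birth` — stub `stub_preserves_blowupChart`

**The total transform of a derivation preserving the local ring at the centre preserves the
local ring of a blow-up chart at the new centre.**
Let `k ⊆ K` be fields, `O` a valuation ring of `K`, `S` a `k`-subalgebra of `K`, and for a
subalgebra `T` write `T_c := {a / b : a b ∈ T, b ≠ 0, b⁻¹ ∈ O}` (the local ring of the model `T`
at the centre of `O`). If `δ := g • D` maps `S_c` into `S_c`, `Z ⊆ S` is finite and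
`x₁ ∈ S ∖ 0`, then for the chart ring `S' := k[S ∪ Z/x₁]` of the blow-up of the ideal generated by
`Z`, the rescaled derivation `δ' := (x₁ g) • D = x₁ δ` maps `S'_c` into `S'_c`.

Proof (elementary bookkeeping of one blow-up step, cf. [Rudakov–Shafarevich 1976, §1],
[Posva 2023, §2]): `S'_c` is a subalgebra containing `S'`, `S_c` and the inverses of its
admissible denominators. (1) `δ'(S') ⊆ S'_c` by induction on `S' = k[S ∪ Z/x₁]`: on `s ∈ S`,
`δ' s = x₁ · δ s ∈ S' · S_c`; on `z/x₁`, `δ'(z/x₁) = δ z − (z/x₁) δ x₁`; `δ'` kills `k`, is additive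
and satisfies Leibniz. (2) the quotient rule `δ'(a/b) = b⁻² (b δ' a − a δ' b)`.
-/

set_option linter.dupNamespace false -- mandated namespace of this single-conjunct summit

noncomputable section

namespace Summit.ResolutionOfSingularities.ResolutionOfSingularities.Theorems.FolLU

namespace BlowupChart

/-- **The local ring at the centre as a subalgebra of `K`.** For a `k`-subalgebra `T` of `K` and a
valuation subring `O` of `K`, the fractions `a / b` with `a b ∈ T`, `b ≠ 0`, `b⁻¹ ∈ O` (i.e. `b` a
unit of `O`) form a `k`-subalgebra of `K`. [folklore] -/
theorem exists_fractions_subalgebra {k K : Type*} [Field k] [Field K] [Algebra k K]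
    (O : ValuationSubring K) (T : Subalgebra k K) :
    ∃ Tc : Subalgebra k K, ∀ x : K, x ∈ Tc ↔
      ∃ a b : K, a ∈ T ∧ b ∈ T ∧ b ≠ 0 ∧ b⁻¹ ∈ O ∧ x = a / b := by
  refine ⟨{ carrier := {x | ∃ a b : K, a ∈ T ∧ b ∈ T ∧ b ≠ 0 ∧ b⁻¹ ∈ O ∧ x = a / b},
            mul_mem' := ?_, add_mem' := ?_, algebraMap_mem' := ?_ }, fun x => Iff.rfl⟩
  · rintro x y ⟨a, b, ha, hb, hb0, hbi, rfl⟩ ⟨c, d, hc, hd, hd0, hdi, rfl⟩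
    refine ⟨a * c, b * d, mul_mem ha hc, mul_mem hb hd, mul_ne_zero hb0 hd0, ?_, ?_⟩
    · rw [mul_inv]
      exact mul_mem hbi hdi
    · rw [div_mul_div_comm]
  · rintro x y ⟨a, b, ha, hb, hb0, hbi, rfl⟩ ⟨c, d, hc, hd, hd0, hdi, rfl⟩
    refine ⟨a * d + b * c, b * d, add_mem (mul_mem ha hd) (mul_mem hb hc), mul_mem hb hd,
      mul_ne_zero hb0 hd0, ?_, ?_⟩
    · rw [mul_inv]
      exact mul_mem hbi hdi
    · rw [div_add_div _ _ hb0 hd0]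
  · intro r
    exact ⟨algebraMap k K r, 1, algebraMap_mem T r, one_mem T, one_ne_zero,
      by rw [inv_one]; exact one_mem O, (div_one _).symm⟩

/-- **Quotient rule.** If `g₀ · D(T) ⊆ T_c` for a subalgebra `T_c ⊇ T` of `K` all of whose
elements are fractions `a / b`, `a b ∈ T`, with `b⁻¹ ∈ T_c`, then `g₀ · D(T_c) ⊆ T_c`.
[folklore] -/
theorem mul_deriv_mem_of_frac {k K : Type*} [Field k] [Field K] [Algebra k K]
    (D : Derivation k K K) (T Tc : Subalgebra k K) (g₀ : K) (hTTc : ∀ x ∈ T, x ∈ Tc)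
    (hTc : ∀ x ∈ Tc, ∃ a b : K, a ∈ T ∧ b ∈ T ∧ b ≠ 0 ∧ b⁻¹ ∈ Tc ∧ x = a / b)
    (hg₀ : ∀ x ∈ T, g₀ * D x ∈ Tc) : ∀ x ∈ Tc, g₀ * D x ∈ Tc := by
  intro x hx
  obtain ⟨a, b, ha, hb, -, hbinv, rfl⟩ := hTc x hx
  have h : g₀ * D (a / b) = b⁻¹ ^ 2 * (b * (g₀ * D a) - a * (g₀ * D b)) := by
    rw [Derivation.leibniz_div]
    simp only [smul_eq_mul]
    ring
  rw [h]
  exact mul_mem (pow_mem hbinv 2)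
    (sub_mem (mul_mem (hTTc b hb) (hg₀ a ha)) (mul_mem (hTTc a ha) (hg₀ b hb)))

end BlowupChart

/-- STUB `stub_preserves_blowupChart` of the crux `FolLU` (line `birth`), in expanded
(definition-free) form: **the total transform `(x₁ g) • D` of a derivation `g • D` preserving
`S_c = {a / b : a b ∈ S, b ∈ O^×}` preserves `S'_c` for the `x₁`-chart `S' = k[S ∪ Z/x₁]` of the
blow-up of the ideal generated by a finite `Z ⊆ S` (`x₁ ∈ S`, `x₁ ≠ 0`).**
[cite: RudakovShafarevich1976, §1] [cite: Posva2023, §2] -/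
theorem stub_preserves_blowupChart :
    ∀ (k K : Type) [Field k] [Field K] [Algebra k K] (O : ValuationSubring K) (S : Subalgebra k K)
    (D : Derivation k K K) (g x₁ : K) (Z : Finset K), (↑Z : Set K) ⊆ S → x₁ ∈ S → x₁ ≠ 0 →
    (∀ x : K, (∃ a b : K, a ∈ S ∧ b ∈ S ∧ b ≠ 0 ∧ b⁻¹ ∈ O ∧ x = a / b) →
      ∃ a b : K, a ∈ S ∧ b ∈ S ∧ b ≠ 0 ∧ b⁻¹ ∈ O ∧ (g • D) x = a / b) →
    ∀ x : K, (∃ a b : K, a ∈ Algebra.adjoin k (↑S ∪ (fun z => z / x₁) '' ↑Z) ∧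
        b ∈ Algebra.adjoin k (↑S ∪ (fun z => z / x₁) '' ↑Z) ∧ b ≠ 0 ∧ b⁻¹ ∈ O ∧ x = a / b) →
      ∃ a b : K, a ∈ Algebra.adjoin k (↑S ∪ (fun z => z / x₁) '' ↑Z) ∧
        b ∈ Algebra.adjoin k (↑S ∪ (fun z => z / x₁) '' ↑Z) ∧ b ≠ 0 ∧ b⁻¹ ∈ O ∧
        ((x₁ * g) • D) x = a / b := by
  intro k K _ _ _ O S D g x₁ Z hZ hx₁S hx₁ hpres
  obtain ⟨Tc, hTc⟩ :=
    BlowupChart.exists_fractions_subalgebra O (Algebra.adjoin k (↑S ∪ (fun z => z / x₁) '' ↑Z))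
  -- basic inclusions: `S ⊆ S'`, `Z/x₁ ⊆ S'`, `S' ⊆ S'_c`, inverses of denominators lie in `S'_c`
  have hST : ∀ y ∈ S, y ∈ Algebra.adjoin k (↑S ∪ (fun z => z / x₁) '' ↑Z) := fun y hy =>
    Algebra.subset_adjoin (Set.mem_union_left _ hy)
  have hZT : ∀ z ∈ Z, z / x₁ ∈ Algebra.adjoin k (↑S ∪ (fun z => z / x₁) '' ↑Z) := fun z hz =>
    Algebra.subset_adjoin (Set.mem_union_right _ ⟨z, hz, rfl⟩)
  have hTTc : ∀ y ∈ Algebra.adjoin k (↑S ∪ (fun z => z / x₁) '' ↑Z), y ∈ Tc := fun y hy =>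
    (hTc y).mpr ⟨y, 1, hy, one_mem _, one_ne_zero, by rw [inv_one]; exact one_mem O,
      (div_one y).symm⟩
  have hinvTc : ∀ b ∈ Algebra.adjoin k (↑S ∪ (fun z => z / x₁) '' ↑Z), b ≠ 0 → b⁻¹ ∈ O →
      b⁻¹ ∈ Tc := fun b hb hb0 hbi =>
    (hTc _).mpr ⟨1, b, one_mem _, hb, hb0, hbi, (one_div b).symm⟩
  -- the hypothesis gives `g · D(S) ⊆ S_c ⊆ S'_c`
  have hδS : ∀ s ∈ S, g * D s ∈ Tc := by
    intro s hs
    obtain ⟨a, b, ha, hb, hb0, hbi, hab⟩ := hpres s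
      ⟨s, 1, hs, one_mem S, one_ne_zero, by rw [inv_one]; exact one_mem O, (div_one s).symm⟩
    rw [Derivation.smul_apply, smul_eq_mul] at hab
    rw [hab]
    exact (hTc _).mpr ⟨a, b, hST a ha, hST b hb, hb0, hbi, rfl⟩
  -- (1) `(x₁ g) · D(S') ⊆ S'_c`, by induction on `S' = k[S ∪ Z/x₁]`
  have h1 : ∀ y ∈ Algebra.adjoin k (↑S ∪ (fun z => z / x₁) '' ↑Z), x₁ * g * D y ∈ Tc := by
    intro y hy
    induction hy using Algebra.adjoin_induction with
    | mem y hy =>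
      rcases hy with hyS | ⟨z, hz, rfl⟩
      · rw [mul_assoc]
        exact mul_mem (hTTc _ (hST _ hx₁S)) (hδS y hyS)
      · have h : x₁ * g * D (z / x₁) = g * D z - z / x₁ * (g * D x₁) := by
          rw [Derivation.leibniz_div]
          simp only [smul_eq_mul]
          field_simp
        rw [h]
        exact sub_mem (hδS z (hZ hz)) (mul_mem (hTTc _ (hZT z hz)) (hδS x₁ hx₁S))
    | algebraMap r =>
      rw [Derivation.map_algebraMap, mul_zero]
      exact zero_mem _
    | add y₁ y₂ _ _ ih₁ ih₂ =>
      rw [map_add, mul_add]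
      exact add_mem ih₁ ih₂
    | mul y₁ y₂ hy₁ hy₂ ih₁ ih₂ =>
      rw [Derivation.leibniz, smul_eq_mul, smul_eq_mul, mul_add, mul_left_comm _ y₁,
        mul_left_comm _ y₂]
      exact add_mem (mul_mem (hTTc _ hy₁) ih₂) (mul_mem (hTTc _ hy₂) ih₁)
  -- (2) the quotient rule extends (1) from `S'` to `S'_c`
  intro x hx
  have hxTc : x ∈ Tc := (hTc x).mpr hx
  have h2 := BlowupChart.mul_deriv_mem_of_frac D _ Tc (x₁ * g) hTTc (fun y hy => by
    obtain ⟨a, b, ha, hb, hb0, hbi, rfl⟩ := (hTc y).mp hy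
    exact ⟨a, b, ha, hb, hb0, hinvTc b hb hb0 hbi, rfl⟩) h1 x hxTc
  rw [Derivation.smul_apply, smul_eq_mul]
  exact (hTc _).mp h2

end Summit.ResolutionOfSingularities.ResolutionOfSingularities.Theorems.FolLU

end
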